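import Summits.ValiantsHypothesis.ValiantsHypothesis.Theorems.KPlusLogSqLawTropicalBAdjacentRecords

/-!
# `TropicalB` (stmt-ValiantsHypothesis-19771) — the LINEAR COMPARABILITY LAW, part 2: the count of members with adjacent record pairs

Helper file for the crux `Theses.KPlusLogSqLaw.TropicalB` (`--supports stmt-ValiantsHypothesis-19771`), cell `pub-symmetroid`,
seat val-sym-trop-p5 (g5, refuter-adjacent lane).  HONEST FRAMING: pure finite combinatorics, the abstract core of the linear
comparability law (part 3, `…TropicalBComparabilityLinear`, instantiates it with the prefix/suffix records of two comparability-
coupled registers and removes the logarithm from the tree's `ComparabilitySum.card_dominant_le`).  Nothing here bears on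
`TropicalB` in its window, `MatrixDescartes` (stmt-ValiantsHypothesis-18050) or VP ≠ VNP.

## Statement (`card_le_of_adjacent_records`)
Along `n` consecutive times `k < n` we are given two subsets `A k, B k ⊆ [0, L)` and one MEMBER per time: positions `y k < p k`
with states `jj k < N`, `uu k < U`, such that
* (adjacency) `y k ∈ A k`, `p k ∈ B k`, and nothing of `A k ∪ B k` lies strictly between `y k` and `p k`;
* (distinctness) the members `(jj, y, p, uu)` are pairwise distinct;
* (few flips) for every position `z`, membership `z ∈ A k` changes at most `2N` times along `k`, `z ∈ B k` at most `2U` times;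
* (state monotonicity) along the members with a fixed first position `y` a statistic `σ₁ (jj k) y` strictly increases whenever
  `jj` changes; likewise `σ₂ p (uu k)` along a fixed second position `p`.
THEN `n ≤ (3(N+U)+1)·L`.

## Proof
A member is RUN-FIRST if its pair `(y, p)` has had no member since the pair last became adjacent.  Run-first members inject into
creation events `(r, π)` («`π` adjacent at time `r` but not at `r − 1`», or `r = 0`): at most `L + Σ_k (|ΔA_k| + |ΔB_k|)` of them
(part 1: `card_adjacent_le`, `card_adjacent_sdiff_le`), and `Σ_k |ΔA_k| ≤ 2N·L` by double counting the flips (`sum_card_flip_le`).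
Any other member has a previous member of the same pair inside its run; by partner uniqueness (part 1: an adjacent pair is
determined by either position) that one is also its previous member with the same `y` AND its previous member with the same `p`,
so the two differ in `jj` or in `uu`; by monotonicity `jj` is injective on the members whose previous same-`y` member carries
another `jj` (`≤ N` per position), `≤ N·L + U·L` in all.  Total `(3(N+U)+1)·L`. [folklore-level counting]
-/

set_option linter.dupNamespace false
set_option autoImplicit false

namespace Summit.ValiantsHypothesis.ValiantsHypothesis.Theorems.KPlusLogSqLaw.ComparabilityLinear

open Finset

/-- **THE COUNT OF MEMBERS WITH ADJACENT RECORD PAIRS.**  Along times `k < n` let `A k, B k ⊆ [0, L)` be two configurations and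
let each time carry a member `(jj k, y k, p k, uu k)` (`jj k < N`, `uu k < U`) such that: `(y k, p k)` is an adjacent pair of
`(A k, B k)`; the members are pairwise distinct; every position's membership in `A k` (resp. `B k`) flips at most `2N` (resp.
`2U`) times; and along the members with a fixed `y` the statistic `σ₁ (jj ·) y` strictly increases whenever `jj` changes
(likewise `σ₂ p (uu ·)` along a fixed `p`).  Then `n ≤ (3(N+U)+1)·L`.
Proof: RUN-FIRST members (no earlier member of the same pair since the pair last became adjacent) inject into creation events,
`≤ L + Σ_k (|ΔA_k| + |ΔB_k|) ≤ L + 2(N+U)L` (`card_adjacent_le`, `card_adjacent_sdiff_le`, `sum_card_flip_le`); any other member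
has a previous member of its pair inside the run, which (partner uniqueness) is also its previous member with the same `y` and
with the same `p`, so `jj` or `uu` changed — and `jj` is injective on the members whose previous same-`y` member has another `jj`
(monotonicity), `≤ N·L + U·L` in all. -/
theorem card_le_of_adjacent_records {L N U : ℕ} (n : ℕ) (A B : ℕ → Finset (Fin L)) (y p : ℕ → Fin L)
    (jj : ℕ → Fin N) (uu : ℕ → Fin U) (σ₁ : Fin N → Fin L → ℤ) (σ₂ : Fin L → Fin U → ℤ)
    (hadj : ∀ k, k < n → y k ∈ A k ∧ p k ∈ B k ∧ y k < p k ∧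
      ∀ z : Fin L, y k < z → z < p k → z ∉ A k ∧ z ∉ B k)
    (hinj : ∀ k k', k < n → k' < n → jj k = jj k' → y k = y k' → p k = p k' → uu k = uu k' → k = k')
    (hflipA : ∀ z : Fin L,
      ((Finset.range n).filter (fun k => k + 1 < n ∧ ¬ (z ∈ A k ↔ z ∈ A (k + 1)))).card ≤ 2 * N)
    (hflipB : ∀ z : Fin L,
      ((Finset.range n).filter (fun k => k + 1 < n ∧ ¬ (z ∈ B k ↔ z ∈ B (k + 1)))).card ≤ 2 * U)
    (hmono₁ : ∀ k k', k < k' → k' < n → y k = y k' → jj k ≠ jj k' → σ₁ (jj k) (y k) < σ₁ (jj k') (y k))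
    (hmono₂ : ∀ k k', k < k' → k' < n → p k = p k' → uu k ≠ uu k' → σ₂ (p k) (uu k) < σ₂ (p k) (uu k')) :
    n ≤ (3 * (N + U) + 1) * L := by
  classical
  rcases Nat.eq_zero_or_pos n with hn0 | hnpos
  · omega
  obtain ⟨n', rfl⟩ : ∃ n', n = n' + 1 := ⟨n - 1, by omega⟩
  -- candidacy of member `k`'s pair at time `m`
  let cand : ℕ → ℕ → Prop := fun m k => y k ∈ A m ∧ p k ∈ B m ∧ y k < p k ∧
    ∀ z : Fin L, y k < z → z < p k → z ∉ A m ∧ z ∉ B m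
  -- the adjacent pairs of time `r`
  let adj : ℕ → Finset (Fin L × Fin L) := fun r => (Finset.univ : Finset (Fin L × Fin L)).filter
    (fun π => π.1 ∈ A r ∧ π.2 ∈ B r ∧ π.1 < π.2 ∧ ∀ z : Fin L, π.1 < z → z < π.2 → z ∉ A r ∧ z ∉ B r)
  have hmem_adj : ∀ r k, (y k, p k) ∈ adj r ↔ cand r k := by
    intro r k
    simp only [adj, cand, Finset.mem_filter, Finset.mem_univ, true_and]
  -- the start of the current run of member `k`'s pair
  have hex : ∀ k, ∃ r, ∀ m, r ≤ m → m ≤ k → k < n' + 1 → cand m k := fun k =>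
    ⟨k, fun m h1 h2 hk => by
      have : m = k := le_antisymm h2 h1
      subst this; exact hadj m hk⟩
  let rk : ℕ → ℕ := fun k => Nat.find (hex k)
  have hrk_spec : ∀ k, ∀ m, rk k ≤ m → m ≤ k → k < n' + 1 → cand m k := fun k => Nat.find_spec (hex k)
  have hrk_le : ∀ k, rk k ≤ k := fun k =>
    Nat.find_min' (hex k) (fun m h1 h2 hk => by
      have : m = k := le_antisymm h2 h1
      subst this; exact hadj m hk)
  have hrk_min : ∀ k, k < n' + 1 → rk k ≠ 0 → ¬ cand (rk k - 1) k := by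
    intro k hk h0 hc
    have hlt : rk k - 1 < rk k := by omega
    have hnot := Nat.find_min (hex k) hlt
    apply hnot
    intro m h1 h2 hk'
    rcases Nat.eq_or_lt_of_le h1 with e | hlt'
    · rw [← e]; exact hc
    · exact hrk_spec k m (by omega) h2 hk'
  -- run-first members and the others
  let RF : Finset ℕ := (Finset.range (n' + 1)).filter
    (fun k => ∀ k', rk k ≤ k' → k' < k → (y k', p k') ≠ (y k, p k))
  let NRF : Finset ℕ := (Finset.range (n' + 1)).filter
    (fun k => ¬ ∀ k', rk k ≤ k' → k' < k → (y k', p k') ≠ (y k, p k))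
  have hsplit : RF.card + NRF.card = n' + 1 := by
    rw [Finset.card_filter_add_card_filter_not, Finset.card_range]
  -- (I) run-first members inject into creation events
  let g : ℕ → ℕ := fun r => ((adj r).filter (fun π => r = 0 ∨ π ∉ adj (r - 1))).card
  let E : Finset (ℕ × (Fin L × Fin L)) := (Finset.range (n' + 1)).biUnion (fun r =>
    ((adj r).filter (fun π => r = 0 ∨ π ∉ adj (r - 1))).image (fun π => (r, π)))
  have hRF : RF.card ≤ E.card := by
    refine Finset.card_le_card_of_injOn (fun k => (rk k, (y k, p k))) (fun k hk => ?_) ?_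
    · have hk' := Finset.mem_filter.1 (Finset.mem_coe.1 hk)
      have hkn : k < n' + 1 := Finset.mem_range.1 hk'.1
      rw [Finset.mem_coe]
      refine Finset.mem_biUnion.2 ⟨rk k, Finset.mem_range.2 (lt_of_le_of_lt (hrk_le k) hkn), ?_⟩
      refine Finset.mem_image.2 ⟨(y k, p k), ?_, rfl⟩
      refine Finset.mem_filter.2 ⟨(hmem_adj (rk k) k).2 (hrk_spec k (rk k) le_rfl (hrk_le k) hkn), ?_⟩
      by_cases h0 : rk k = 0
      · exact Or.inl h0
      · exact Or.inr fun h => hrk_min k hkn h0 ((hmem_adj _ k).1 h)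
    · intro k₁ hk₁ k₂ hk₂ he
      have h1 := (Finset.mem_filter.1 (Finset.mem_coe.1 hk₁)).2
      have h2 := (Finset.mem_filter.1 (Finset.mem_coe.1 hk₂)).2
      simp only [Prod.mk.injEq] at he
      obtain ⟨hr, hy, hp⟩ := he
      by_contra hne
      rcases lt_or_gt_of_ne hne with hlt | hlt
      · exact h2 k₁ (by rw [← hr]; exact hrk_le k₁) hlt (by rw [hy, hp])
      · exact h1 k₂ (by rw [hr]; exact hrk_le k₂) hlt (by rw [hy, hp])
  have hE : E.card ≤ ∑ r ∈ Finset.range (n' + 1), g r := by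
    refine le_trans Finset.card_biUnion_le (Finset.sum_le_sum fun r _ => ?_)
    exact Finset.card_image_le
  have hg0 : g 0 ≤ L := le_trans (Finset.card_filter_le _ _) (card_adjacent_le (A 0) (B 0))
  have hgs : ∀ k, g (k + 1) ≤
      ((Finset.univ : Finset (Fin L)).filter (fun z => ¬ (z ∈ A k ↔ z ∈ A (k + 1)))).card +
      ((Finset.univ : Finset (Fin L)).filter (fun z => ¬ (z ∈ B k ↔ z ∈ B (k + 1)))).card := by
    intro k
    refine le_trans (Finset.card_le_card ?_) (card_adjacent_sdiff_le (A k) (B k) (A (k + 1)) (B (k + 1)))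
    intro π hπ
    obtain ⟨h1, h2⟩ := Finset.mem_filter.1 hπ
    rcases h2 with h | h
    · omega
    · have e : k + 1 - 1 = k := by omega
      rw [e] at h
      exact Finset.mem_sdiff.2 ⟨h1, h⟩
  have hsumg : ∑ r ∈ Finset.range (n' + 1), g r ≤ L + 2 * N * L + 2 * U * L := by
    rw [Finset.sum_range_succ']
    have hA := sum_card_flip_le (n' + 1) A N n' le_rfl hflipA
    have hB := sum_card_flip_le (n' + 1) B U n' le_rfl hflipB
    have : ∑ k ∈ Finset.range n', g (k + 1) ≤
        ∑ k ∈ Finset.range n', ((Finset.univ : Finset (Fin L)).filter (fun z => ¬ (z ∈ A k ↔ z ∈ A (k + 1)))).card +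
        ∑ k ∈ Finset.range n', ((Finset.univ : Finset (Fin L)).filter (fun z => ¬ (z ∈ B k ↔ z ∈ B (k + 1)))).card := by
      rw [← Finset.sum_add_distrib]
      exact Finset.sum_le_sum fun k _ => hgs k
    omega
  -- (II) the other members have a previous member of the same pair inside the run
  let JCH : Finset ℕ := (Finset.range (n' + 1)).filter
    (fun k => ∃ k', k' < k ∧ y k' = y k ∧ jj k' ≠ jj k ∧ ∀ m, k' < m → m < k → y m ≠ y k)
  let UCH : Finset ℕ := (Finset.range (n' + 1)).filter
    (fun k => ∃ k', k' < k ∧ p k' = p k ∧ uu k' ≠ uu k ∧ ∀ m, k' < m → m < k → p m ≠ p k)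
  have hNRF : NRF ⊆ JCH ∪ UCH := by
    intro k hk
    obtain ⟨hkn, hnot⟩ := Finset.mem_filter.1 hk
    rw [Finset.mem_range] at hkn
    push Not at hnot
    let S : Finset ℕ := (Finset.range k).filter (fun k' => rk k ≤ k' ∧ (y k', p k') = (y k, p k))
    have hSne : S.Nonempty := by
      obtain ⟨k', h1, h2, h3⟩ := hnot
      exact ⟨k', Finset.mem_filter.2 ⟨Finset.mem_range.2 h2, h1, h3⟩⟩
    have hk₀S : S.max' hSne ∈ S := Finset.max'_mem S hSne
    obtain ⟨hk₀k, hrk₀, hπ₀⟩ := Finset.mem_filter.1 hk₀S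
    rw [Finset.mem_range] at hk₀k
    have hmax : ∀ m ∈ S, m ≤ S.max' hSne := fun m hm => Finset.le_max' S m hm
    simp only [Prod.mk.injEq] at hπ₀
    obtain ⟨hyeq, hpeq⟩ := hπ₀
    have hbetween_y : ∀ m, S.max' hSne < m → m < k → y m ≠ y k := by
      intro m h1 h2 he
      have hcm : cand m k := hrk_spec k m (by omega) h2.le hkn
      have ham := hadj m (by omega)
      rw [he] at ham
      have hpm : p m = p k := snd_eq_of_adjacent ham hcm
      have hmS : m ∈ S := Finset.mem_filter.2 ⟨Finset.mem_range.2 h2, by omega, by rw [he, hpm]⟩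
      exact absurd (hmax m hmS) (by omega)
    have hbetween_p : ∀ m, S.max' hSne < m → m < k → p m ≠ p k := by
      intro m h1 h2 he
      have hcm : cand m k := hrk_spec k m (by omega) h2.le hkn
      have ham := hadj m (by omega)
      rw [he] at ham
      have hym : y m = y k := fst_eq_of_adjacent ham hcm
      have hmS : m ∈ S := Finset.mem_filter.2 ⟨Finset.mem_range.2 h2, by omega, by rw [he, hym]⟩
      exact absurd (hmax m hmS) (by omega)
    have hne : jj (S.max' hSne) ≠ jj k ∨ uu (S.max' hSne) ≠ uu k := by
      by_contra h
      push Not at h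
      have := hinj (S.max' hSne) k (by omega) hkn h.1 hyeq hpeq h.2
      omega
    rcases hne with hj | hu
    · exact Finset.mem_union.2 (Or.inl (Finset.mem_filter.2
        ⟨Finset.mem_range.2 hkn, S.max' hSne, hk₀k, hyeq, hj, hbetween_y⟩))
    · exact Finset.mem_union.2 (Or.inr (Finset.mem_filter.2
        ⟨Finset.mem_range.2 hkn, S.max' hSne, hk₀k, hpeq, hu, hbetween_p⟩))
  -- (III) per position, `jj` is injective on `JCH` (and `uu` on `UCH`)
  have hJ : JCH.card ≤ N * L := by
    have hfib : JCH.card = ∑ y₀ : Fin L, (JCH.filter (fun k => y k = y₀)).card :=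
      Finset.card_eq_sum_card_fiberwise (fun k _ => Finset.mem_coe.2 (Finset.mem_univ (y k)))
    rw [hfib]
    calc ∑ y₀ : Fin L, (JCH.filter (fun k => y k = y₀)).card ≤ ∑ _y₀ : Fin L, N :=
          Finset.sum_le_sum fun y₀ _ => ?_
      _ = N * L := by simp [mul_comm]
    have key : ∀ k₁ ∈ JCH.filter (fun k => y k = y₀), ∀ k₂ ∈ JCH.filter (fun k => y k = y₀),
        k₁ < k₂ → jj k₁ ≠ jj k₂ := by
      intro k₁ hk₁ k₂ hk₂ hlt heq
      obtain ⟨-, hy₁⟩ := Finset.mem_filter.1 hk₁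
      obtain ⟨hk₂J, hy₂⟩ := Finset.mem_filter.1 hk₂
      obtain ⟨hk₂n, k', hk'lt, hy', hj', hbtw⟩ := Finset.mem_filter.1 hk₂J
      rw [Finset.mem_range] at hk₂n
      have hk₁le : k₁ ≤ k' := by
        by_contra h
        exact hbtw k₁ (by omega) hlt (by rw [hy₁, hy₂])
      have hlt2 : σ₁ (jj k') (y k') < σ₁ (jj k₂) (y k') := hmono₁ k' k₂ hk'lt hk₂n hy' hj'
      rcases Nat.eq_or_lt_of_le hk₁le with e | hlt1
      · subst e; exact hj' heq
      · by_cases hj1 : jj k₁ = jj k'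
        · exact hj' (hj1.symm.trans heq)
        · have hy1' : y k₁ = y k' := by rw [hy₁, ← hy₂, hy']
          have hlt1' := hmono₁ k₁ k' hlt1 (by omega) hy1' hj1
          rw [hy1', heq] at hlt1'
          exact absurd (hlt1'.trans hlt2) (lt_irrefl _)
    have h := Finset.card_le_card_of_injOn (s := JCH.filter (fun k => y k = y₀))
      (t := (Finset.univ : Finset (Fin N))) jj (fun k _ => Finset.mem_coe.2 (Finset.mem_univ _)) ?_
    · simpa using h
    · intro k₁ hk₁ k₂ hk₂ he
      by_contra hne
      rcases lt_or_gt_of_ne hne with hlt | hlt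
      · exact key k₁ (Finset.mem_coe.1 hk₁) k₂ (Finset.mem_coe.1 hk₂) hlt he
      · exact key k₂ (Finset.mem_coe.1 hk₂) k₁ (Finset.mem_coe.1 hk₁) hlt he.symm
  have hUc : UCH.card ≤ U * L := by
    have hfib : UCH.card = ∑ p₀ : Fin L, (UCH.filter (fun k => p k = p₀)).card :=
      Finset.card_eq_sum_card_fiberwise (fun k _ => Finset.mem_coe.2 (Finset.mem_univ (p k)))
    rw [hfib]
    calc ∑ p₀ : Fin L, (UCH.filter (fun k => p k = p₀)).card ≤ ∑ _p₀ : Fin L, U :=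
          Finset.sum_le_sum fun p₀ _ => ?_
      _ = U * L := by simp [mul_comm]
    have key : ∀ k₁ ∈ UCH.filter (fun k => p k = p₀), ∀ k₂ ∈ UCH.filter (fun k => p k = p₀),
        k₁ < k₂ → uu k₁ ≠ uu k₂ := by
      intro k₁ hk₁ k₂ hk₂ hlt heq
      obtain ⟨-, hp₁⟩ := Finset.mem_filter.1 hk₁
      obtain ⟨hk₂J, hp₂⟩ := Finset.mem_filter.1 hk₂
      obtain ⟨hk₂n, k', hk'lt, hp', hu', hbtw⟩ := Finset.mem_filter.1 hk₂J
      rw [Finset.mem_range] at hk₂n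
      have hk₁le : k₁ ≤ k' := by
        by_contra h
        exact hbtw k₁ (by omega) hlt (by rw [hp₁, hp₂])
      have hlt2 : σ₂ (p k') (uu k') < σ₂ (p k') (uu k₂) := hmono₂ k' k₂ hk'lt hk₂n hp' hu'
      rcases Nat.eq_or_lt_of_le hk₁le with e | hlt1
      · subst e; exact hu' heq
      · by_cases hu1 : uu k₁ = uu k'
        · exact hu' (hu1.symm.trans heq)
        · have hp1' : p k₁ = p k' := by rw [hp₁, ← hp₂, hp']
          have hlt1' := hmono₂ k₁ k' hlt1 (by omega) hp1' hu1
          rw [hp1', heq] at hlt1'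
          exact absurd (hlt1'.trans hlt2) (lt_irrefl _)
    have h := Finset.card_le_card_of_injOn (s := UCH.filter (fun k => p k = p₀))
      (t := (Finset.univ : Finset (Fin U))) uu (fun k _ => Finset.mem_coe.2 (Finset.mem_univ _)) ?_
    · simpa using h
    · intro k₁ hk₁ k₂ hk₂ he
      by_contra hne
      rcases lt_or_gt_of_ne hne with hlt | hlt
      · exact key k₁ (Finset.mem_coe.1 hk₁) k₂ (Finset.mem_coe.1 hk₂) hlt he
      · exact key k₂ (Finset.mem_coe.1 hk₂) k₁ (Finset.mem_coe.1 hk₁) hlt he.symm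
  -- assembly
  have hNRFc : NRF.card ≤ N * L + U * L :=
    le_trans (Finset.card_le_card hNRF) (le_trans (Finset.card_union_le _ _) (Nat.add_le_add hJ hUc))
  have htot : n' + 1 ≤ (L + 2 * N * L + 2 * U * L) + (N * L + U * L) := by
    rw [← hsplit]
    exact Nat.add_le_add (le_trans hRF (le_trans hE hsumg)) hNRFc
  have hring : (3 * (N + U) + 1) * L = (L + 2 * N * L + 2 * U * L) + (N * L + U * L) := by ring
  rw [hring]
  exact htot

end Summit.ValiantsHypothesis.ValiantsHypothesis.Theorems.KPlusLogSqLaw.ComparabilityLinear
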